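import Summits.QuantumFields.YangMills.Theorems.UnitScaleTiltProp7UntwistCornerData
import Summits.QuantumFields.YangMills.Theorems.UnitScaleTiltProp7TwistRegauge
import Summits.QuantumFields.YangMills.Theorems.UnitScaleTiltProp7UntwistedChartOfBlend
import HarnessLib

/-!
# Route `UnitScaleTilt`, crux K1 child «MinimiserStabilityRegPr» (stmt-QuantumFields-19200), route-R ∕ α-P second line, E′ growth side under
# ★★OWNER RULING g27-№8 «UNTWISTED (U2)» — R2 (c), ASSEMBLY: THE UNTWISTED CHART OF RECORD `D‴ = −i·log((X^g)_b·W_b⁻¹)` OF A TWISTED PAIR `(X, u)`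
# (`X^u ∈ (6)(e) ∩ 𝔅_k(V)`): rows (i) sup, (ii) action, (iii) untwisted membership of the E′ final door

Cell `ym3-torus` ∕ width seat `ym-ust-19200-w1` (gen 11; R2 (c) hand per ★★OWNER RULING g27-№8 (2), recipe of ★p1 g14, bus 2026-08-28 16:22:42Z).  THEOREMS ONLY
(0 `def`, 0 `sorry`); `--supports stmt-QuantumFields-19200`, count-neutral.  YM₃ on T³ is a ladder rung (R3), not the Clay problem; nothing here claims the stub,
the crux, d = 4 or the mass gap; E′ is NOT closed by this file.

WHY.  The sibling file ✓`Prop7UntwistCornerData` proves the three cell estimates for the W-comb-transported centre gauge `vE x y = W(Γ_{c_y,x})⁻¹·u(c_y)·W(Γ_{c_y,x})`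
(adjacent∕arbitrary corners `≤ 3((449∕2)e + τ)` from the fibre identity and the coarse twist `τ`, transport `≤ s + 6e·L^{−(K−n)}` by the commutator identity — no smallness
of `u`).  Here they are packaged as the `hSU`∕`hcentre`∕`hvv`∕`htr` data of ★p1 g14's ✓`Prop7TwistRegauge.exists_untwistedRegauge_T3` (gen 9's prescribed-centre blend),
which re-gauges `X` onto the untwisted fibre with the pointwise bound `1600·L^{−(K−n)}·D + 4096·ρ`; the Hermitian logarithm of ✓`Prop7UntwistedChartOfBlend` (§1) then
gives `D‴` with rows (i)(ii)(iii) of ✓`Prop7LocMinOfChartSliceHess.stub_PV3E_of_chartSliceHess` — and, per the namer (★p1 g14, bus 17:02Z), `D‴` (at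
`X := emb15 W (expHermField (η•A))`, Thm 2's `u`) is THE REPRESENTATIVE OF RECORD FOR ✓`Prop7LocMinOfPinnedChartSlice.stub_PV3E_of_pinnedChartSlice`'s INPUT (path (α′):
`D₀ := D‴`, then re-gauged inside the pinned group to the DIV-optimal `S_H` representative).  The fibre identity `u(c_y)X̄(c)u(c_{y′})⁻¹ = W̄(c)` is DERIVED from membership (✓`iter_gaugeAct_centre_eq_of_mem`), and the coarse
twist is bounded by `2σ` from any sup `dist1(u(c_y)) ≤ σ` (`twist_le_of_sup`; print's `σ < 16dB₁(α₀+α₁)`, [Balaban1985RegularSpaces] (1.70)–(1.72)).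

WHAT IS PROVED (ns `…Theorems.Prop7UntwistChartOfTwist`).  ★★ `exists_untwistedRegauge_of_twist_T3` (`∃ g`, `X^g ∈ (6)(e) ∩ 𝔅_k(V)`,
`‖pertVar W (X^g) b‖ ≤ (4800((449∕2)e + τ) + 24576e)·L^{−(K−n)} + 4096s`), `twist_le_of_sup` (`τ ≤ 2σ`), ★★ `exists_untwistedChart_of_twist_T3` (rows (i)(ii)(iii)).

HONEST SCOPE.  Bookkeeping; `s` (the bondwise sup of `X_bW_b⁻¹ − 1`, print's chart sup) and `τ` (or `σ`) are displayed; rows (iv)∕(v) of the E′ door and the `S_H` re-gauging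
are not touched; the pair-blend chart of ✓`Prop7UntwistedChartOfBlend` gives the same three rows for every competitor without `(X, u)` — this file's `D‴` is the one tied to print's
Landau field.  (The same cell data were typed independently and concurrently by ym3-torus-px7 g0, unfiled, HOME `ym3-torus-px7/…UntwistCornerCells∕Family.px7.lean`.)

References: T. Bałaban, CMP 102 (1985) 277–309 [Balaban1985Variational] ((4)–(6) p.278, (15) p.280, (18) p.280, (112) p.294, (141)–(143) p.299); CMP 99 (1985) 75–102
[Balaban1985RegularSpaces] (Lemma 1 (1.25) p.79, (1.29)–(1.30) p.81, (1.70)–(1.72) p.88); CMP 98 (1985) 17–51 [Balaban1985Averaging] ((11)–(13) p.19, pp.24–25).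
-/

noncomputable section

open NormedSpace
open scoped Matrix.Norms.L2Operator

namespace Summit.QuantumFields.YangMills.Theorems.Prop7UntwistChartOfTwist

open Literature.MathematicalPhysics.QuantumFieldTheory.Balaban1983to89
open T4Continuum BlockAveraging
open B10Eq27TorusAxialLog (axialT transl rel axialT_self)
open B7Prop1Explicit renaming Site → LSite
open B5Eq118OneStroke (iterBlockOf)
open B15DeterminingSets (embIter)
open MatrixLog (mlog)
open Literature.MathematicalPhysics.QuantumFieldTheory.Balaban1983to89.T3ContinuumYM3Torus
open Literature.MathematicalPhysics.QuantumFieldTheory.Balaban1983to89.T3UnitLawDensityEML (ℰp)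
open Literature.MathematicalPhysics.QuantumFieldTheory.Balaban1983to89.T3ConstrainedMinimiser (fibre)
open Literature.MathematicalPhysics.QuantumFieldTheory.Balaban1983to89.T3RegularMinimiser (regThreshold)
open Literature.MathematicalPhysics.QuantumFieldTheory.Balaban1983to89.T3PrintedRegularMinimiser (RegPr RegPr.plaqSmall regFibrePr mem_regFibrePr_iff)
open Literature.MathematicalPhysics.QuantumFieldTheory.Balaban1983to89.T3SectALandauChart (emb15 pos_of_regPr)
open BlockAveragingEMLLinearisedBackground (pertVar pertVar_eq)
open Summit.QuantumFields.YangMills.Theorems.Prop7AxialGaugeFace (exists_off_embIter)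
open Summit.QuantumFields.YangMills.Theorems.Prop7BlendCells
open Summit.QuantumFields.YangMills.Theorems.Prop7BlendCorners
open Summit.QuantumFields.YangMills.Theorems.Prop7BlendSite (coe_inv_SU dist1_mul_inv_eq dist1_transport_eq)
open Summit.QuantumFields.YangMills.Theorems.Prop7BlendedGauge (three_le_sitesPerDir)
open Summit.QuantumFields.YangMills.Theorems.Prop7TwistRegauge (exists_untwistedRegauge_T3)
open Summit.QuantumFields.YangMills.Theorems.Prop7TPrint (expHerm expHermField expHermField_apply)
open Summit.QuantumFields.YangMills.Theorems.Prop7UntwistedChartOfBlend (hermLog_isHermitian hermLog_trace norm_hermLog_le expHerm_hermLog)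
open Summit.QuantumFields.YangMills.Theorems.Prop7UntwistCornerData

/-! ## The cell data and the untwisted chart of record -/

section Assembly

open Literature.MathematicalPhysics.QuantumFieldTheory.Balaban1983to89.T3ContinuumYM3Torus

variable (F : T3Family) {n K : ℕ} (h : n ≤ K)

/-- ★★ **RE-GAUGING THE TWISTED PAIR `(X, u)` ONTO THE UNTWISTED FIBRE WITH A POINTWISE BOUND** (✓`exists_untwistedRegauge_T3` fed with the W-comb-transported centre gauge).
`L ≥ 7`; `W, X^u ∈ (6)(e) ∩ 𝔅_k(V)`; `dist1(X_b·W_b⁻¹) ≤ s` on every bond; coarse twist `dist1(X̄(c)·W̄(c)⁻¹) ≤ τ`; windows `50(500L+7L²)e ≤ 1`, `4800((449∕2)e + τ) ≤ 1`,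
`4096(s + 6e) ≤ 1`.  Then there is `g` with `X^g ∈ (6)(e) ∩ 𝔅_k(V)` and `‖pertVar W (X^g) b‖ ≤ (4800((449∕2)e + τ) + 24576e)·L^{−(K−n)} + 4096s` on every bond.
[cite: Balaban1985Variational, (4)-(6) p.278, (18) p.280; Balaban1985RegularSpaces, Lemma 1 p.79, (1.29)-(1.30) p.81] -/
theorem exists_untwistedRegauge_of_twist_T3 (hL : 7 ≤ F.L) {e s τ : ℝ} (hτ0 : 0 ≤ τ)
    (hε0 : 50 * (500 * (F.L : ℝ) + 7 * (F.L : ℝ) ^ 2) * e ≤ 1) (hD : 4800 * ((449 / 2) * e + τ) ≤ 1) (hρ : 4096 * (s + 6 * e) ≤ 1)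
    {V : GaugeField (F.P n) 0 (Matrix.specialUnitaryGroup (Fin 2) ℂ)} (W X : GaugeField (F.P K) 0 (Matrix.specialUnitaryGroup (Fin 2) ℂ))
    (u : GaugeTransf (F.P K) 0 (Matrix.specialUnitaryGroup (Fin 2) ℂ))
    (hW : W ∈ regFibrePr F n K h e V) (hXu : GaugeField.gaugeAct u X ∈ regFibrePr F n K h e V)
    (hs : ∀ b : PBond (F.P K) 0, dist1 (X b * (W b)⁻¹) ≤ s)
    (hτ : ∀ c : PBond (F.P K) (K - n), dist1 (Averaging.iter (fun j => blockAvg (P := F.P K) (j := j) (ExpMeanLog.expMeanLogSU (n := Fin 2))) (K - n) X c *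
        (Averaging.iter (fun j => blockAvg (P := F.P K) (j := j) (ExpMeanLog.expMeanLogSU (n := Fin 2))) (K - n) W c)⁻¹) ≤ τ) :
    ∃ g : GaugeTransf (F.P K) 0 (Matrix.specialUnitaryGroup (Fin 2) ℂ),
      GaugeField.gaugeAct g X ∈ regFibrePr F n K h e V ∧
      ∀ b : PBond (F.P K) 0, ‖pertVar W (GaugeField.gaugeAct g X) b‖ ≤
        (4800 * ((449 / 2) * e + τ) + 24576 * e) * (((F.L : ℝ))⁻¹) ^ (K - n) + 4096 * s := by
  have hWr : RegPr F n K e W := ((mem_regFibrePr_iff F).mp hW).2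
  have he : 0 < e := pos_of_regPr F hWr
  have hk : K - n ≤ (F.P K).m + (F.P K).K := by show K - n ≤ F.m + K; omega
  have hN : 3 ≤ (F.P K).sitesPerDir (K - n) := three_le_sitesPerDir F hL
  obtain ⟨off, -, hoff⟩ := exists_off_embIter (P := F.P K) (K - n) hk
  have hLL : (F.P K).L = F.L := rfl
  have hpos : 0 < F.L ^ (K - n) := pow_pos (by omega) _
  have hL0 : (0 : ℝ) < (F.L : ℝ) := by exact_mod_cast (show 0 < F.L by omega)
  have hη1 : (((F.L : ℝ))⁻¹) ^ (K - n) ≤ 1 := pow_le_one₀ (inv_nonneg.mpr hL0.le) (inv_le_one_of_one_le₀ (by exact_mod_cast (show 1 ≤ F.L by omega)))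
  have hη0 : 0 ≤ (((F.L : ℝ))⁻¹) ^ (K - n) := pow_nonneg (inv_nonneg.mpr hL0.le) _
  have htwist := iter_gaugeAct_centre_eq_of_mem F h W X u hW hXu
  -- the corner gauge (group-valued) and its matrix reading
  let vG : Site (F.P K) 0 → Site (F.P K) (K - n) → Matrix.specialUnitaryGroup (Fin 2) ℂ :=
    fun x y => (axialT W (embIter (K - n) y) x)⁻¹ * u (embIter (K - n) y) * axialT W (embIter (K - n) y) x
  let vE : Site (F.P K) 0 → Site (F.P K) (K - n) → Matrix (Fin 2) (Fin 2) ℂ := fun x y => ((vG x y : Matrix.specialUnitaryGroup (Fin 2) ℂ) : Matrix (Fin 2) (Fin 2) ℂ)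
  set D : ℝ := 3 * ((449 / 2) * e + τ) with hDdef
  set ρ : ℝ := s + 6 * e * (((F.L : ℝ))⁻¹) ^ (K - n) with hρdef
  have hD' : D ≤ 1 / 1600 := by rw [hDdef]; linarith
  have hρ' : ρ ≤ 1 / 4096 := by
    rw [hρdef]
    have : 6 * e * (((F.L : ℝ))⁻¹) ^ (K - n) ≤ 6 * e * 1 := by gcongr
    linarith
  -- the cell data
  have hform : ∀ (z : Site (F.P K) 0) (ε : LSite (F.P K).d), (∀ ν, ε ν = 0 ∨ ε ν = 1) → ∀ κ,
      rel (embIter (K - n) (transl (iterBlockOf (K - n) (transl z (fun _ => -(off : ℤ)))) ε)) z κ =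
        (((((transl z (fun _ => -(off : ℤ))) κ).val % F.L ^ (K - n) : ℕ)) : ℤ) - ε κ * ((F.L ^ (K - n) : ℕ) : ℤ) := by
    intro z ε hε κ
    have := rel_corner_eq hk hN hoff z ε hε κ
    rw [hLL] at this; exact this
  have hform' : ∀ (z : Site (F.P K) 0) (μ : Fin (F.P K).d) (ε : LSite (F.P K).d), (∀ ν, ε ν = 0 ∨ ε ν = 1) → ∀ κ,
      rel (embIter (K - n) (transl (iterBlockOf (K - n) (transl z (fun _ => -(off : ℤ)))) ε)) (z.shift μ) κ =
        ((((((transl z (fun _ => -(off : ℤ))) κ).val % F.L ^ (K - n) : ℕ)) : ℤ) + if κ = μ then 1 else 0) - ε κ * ((F.L ^ (K - n) : ℕ) : ℤ) := by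
    intro z μ ε hε κ
    have := rel_corner_shift_eq hk hN hoff z ε hε μ κ
    rw [hLL] at this
    rw [this]; ring
  have hρ1 : ∀ (z : Site (F.P K) 0) (κ : Fin (F.P K).d),
      (0 : ℤ) ≤ (((((transl z (fun _ => -(off : ℤ))) κ).val % F.L ^ (K - n) : ℕ)) : ℤ) ∧
        (((((transl z (fun _ => -(off : ℤ))) κ).val % F.L ^ (K - n) : ℕ)) : ℤ) ≤ F.L ^ (K - n) := fun z κ =>
    ⟨by positivity, by exact_mod_cast (Nat.mod_lt _ hpos).le⟩
  have hρ2 : ∀ (z : Site (F.P K) 0) (μ κ : Fin (F.P K).d),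
      (0 : ℤ) ≤ (((((transl z (fun _ => -(off : ℤ))) κ).val % F.L ^ (K - n) : ℕ)) : ℤ) + (if κ = μ then 1 else 0) ∧
        (((((transl z (fun _ => -(off : ℤ))) κ).val % F.L ^ (K - n) : ℕ)) : ℤ) + (if κ = μ then 1 else 0) ≤ F.L ^ (K - n) := by
    intro z μ κ
    have h1 := Nat.mod_lt (((transl z (fun _ => -(off : ℤ))) κ).val) hpos
    refine ⟨by positivity, ?_⟩
    split_ifs
    · exact_mod_cast h1
    · push_cast; rw [add_zero]; exact_mod_cast h1.le
  have hvv : ∀ (z : Site (F.P K) 0) (μ : Fin (F.P K).d) (ε ε' : LSite (F.P K).d), (∀ ν, ε ν = 0 ∨ ε ν = 1) → (∀ ν, ε' ν = 0 ∨ ε' ν = 1) →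
      ‖vE z (transl (iterBlockOf (K - n) (transl z (fun _ => -(off : ℤ)))) ε) *
          star (vE z (transl (iterBlockOf (K - n) (transl z (fun _ => -(off : ℤ)))) ε')) - 1‖ ≤ D ∧
      ‖vE (z.shift μ) (transl (iterBlockOf (K - n) (transl z (fun _ => -(off : ℤ)))) ε) *
          star (vE (z.shift μ) (transl (iterBlockOf (K - n) (transl z (fun _ => -(off : ℤ)))) ε')) - 1‖ ≤ D := by
    intro z μ ε ε' hε hε'
    constructor
    · have hp := dist1_vE_pair_le_T3 F n K hL he hτ0 hε0 W X u hWr htwist hτ (iterBlockOf (K - n) (transl z (fun _ => -(off : ℤ)))) z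
        (fun κ => (((((transl z (fun _ => -(off : ℤ))) κ).val % F.L ^ (K - n) : ℕ)) : ℤ)) (hρ1 z) (hform z) ε ε' hε hε'
      rwa [dist1_mul_inv_eq] at hp
    · have hp := dist1_vE_pair_le_T3 F n K hL he hτ0 hε0 W X u hWr htwist hτ (iterBlockOf (K - n) (transl z (fun _ => -(off : ℤ)))) (z.shift μ)
        (fun κ => (((((transl z (fun _ => -(off : ℤ))) κ).val % F.L ^ (K - n) : ℕ)) : ℤ) + if κ = μ then 1 else 0) (hρ2 z μ) (hform' z μ) ε ε' hε hε'
      rwa [dist1_mul_inv_eq] at hp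
  have htr : ∀ (z : Site (F.P K) 0) (μ : Fin (F.P K).d) (ε : LSite (F.P K).d), (∀ ν, ε ν = 0 ∨ ε ν = 1) →
      ‖vE z (transl (iterBlockOf (K - n) (transl z (fun _ => -(off : ℤ)))) ε) *
          ((X ⟨z, μ⟩ : Matrix.specialUnitaryGroup (Fin 2) ℂ) : Matrix (Fin 2) (Fin 2) ℂ) *
          star (vE (z.shift μ) (transl (iterBlockOf (K - n) (transl z (fun _ => -(off : ℤ)))) ε)) *
          star ((W ⟨z, μ⟩ : Matrix.specialUnitaryGroup (Fin 2) ℂ) : Matrix (Fin 2) (Fin 2) ℂ) - 1‖ ≤ ρ := by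
    intro z μ ε hε
    have ht := dist1_vE_transport_le_T3 F n K hk hN hoff he.le W X u hWr hs z ε hε μ
    rwa [dist1_transport_eq] at ht
  have hSU : ∀ x y, vE x y ∈ Matrix.specialUnitaryGroup (Fin 2) ℂ := fun x y => Subtype.coe_prop _
  have hcentre : ∀ y, vE (embIter (K - n) y) y = ((u (embIter (K - n) y) : Matrix.specialUnitaryGroup (Fin 2) ℂ) : Matrix (Fin 2) (Fin 2) ℂ) := by
    intro y
    show (((axialT W (embIter (K - n) y) (embIter (K - n) y))⁻¹ * u (embIter (K - n) y) * axialT W (embIter (K - n) y) (embIter (K - n) y) :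
      Matrix.specialUnitaryGroup (Fin 2) ℂ) : Matrix (Fin 2) (Fin 2) ℂ) = _
    rw [axialT_self, inv_one, one_mul, mul_one]
  obtain ⟨g, hg, hbound⟩ := exists_untwistedRegauge_T3 F h hL he.le W X u hXu hoff vE hSU hcentre (fun _ _ => D) (fun _ _ => ρ)
    (fun _ _ => hD') (fun _ _ => hρ') (fun z μ ε ε' hε hε' => hvv z μ ε ε' hε hε') (fun z μ ε hε => htr z μ ε hε)
  refine ⟨g, hg, fun b => ?_⟩
  obtain ⟨z, μ⟩ := b
  refine (hbound z μ).trans (le_of_eq ?_)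
  rw [hDdef, hρdef]; ring

/-- **THE COARSE TWIST FROM A SUP ON `u`**: the fibre identity and `dist1(u(x)) ≤ σ` at the centres give `dist1(X̄(c)·W̄(c)⁻¹) ≤ 2σ`
(print's `σ = sup|u − 1| < 16dB₁(α₀+α₁)`, [Balaban1985RegularSpaces] (1.70)–(1.72) p. 88). [cite: Balaban1985RegularSpaces, (1.70)-(1.72) p.88, (1.29)-(1.30) p.81] -/
theorem twist_le_of_sup {e σ : ℝ} {V : GaugeField (F.P n) 0 (Matrix.specialUnitaryGroup (Fin 2) ℂ)}
    (W X : GaugeField (F.P K) 0 (Matrix.specialUnitaryGroup (Fin 2) ℂ)) (u : GaugeTransf (F.P K) 0 (Matrix.specialUnitaryGroup (Fin 2) ℂ))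
    (hW : W ∈ regFibrePr F n K h e V) (hXu : GaugeField.gaugeAct u X ∈ regFibrePr F n K h e V)
    (hσ : ∀ y : Site (F.P K) (K - n), dist1 (u (embIter (K - n) y)) ≤ σ) (c : PBond (F.P K) (K - n)) :
    dist1 (Averaging.iter (fun j => blockAvg (P := F.P K) (j := j) (ExpMeanLog.expMeanLogSU (n := Fin 2))) (K - n) X c *
        (Averaging.iter (fun j => blockAvg (P := F.P K) (j := j) (ExpMeanLog.expMeanLogSU (n := Fin 2))) (K - n) W c)⁻¹) ≤ 2 * σ := by
  have hid := iter_gaugeAct_centre_eq_of_mem F h W X u hW hXu c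
  set Xb := Averaging.iter (fun j => blockAvg (P := F.P K) (j := j) (ExpMeanLog.expMeanLogSU (n := Fin 2))) (K - n) X c
  set u₁ := u (embIter (K - n) c.src)
  set u₂ := u (embIter (K - n) c.tgt)
  rw [← hid]
  have e1 : Xb * (u₁ * Xb * u₂⁻¹)⁻¹ = (Xb * u₂ * Xb⁻¹) * u₁⁻¹ := by group
  rw [e1]
  calc dist1 ((Xb * u₂ * Xb⁻¹) * u₁⁻¹) ≤ dist1 (Xb * u₂ * Xb⁻¹) + dist1 u₁⁻¹ := GaugeGroup.dist1_mul_le _ _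
    _ ≤ σ + σ := by rw [GaugeGroup.dist1_conj, GaugeGroup.dist1_inv]; exact add_le_add (hσ _) (hσ _)
    _ = 2 * σ := by ring

/-- ★★ **THE UNTWISTED CHART OF RECORD — rows (i)(ii)(iii) of the E′ final door for a twisted pair `(X, u)`.**  Under the hypotheses of
`exists_untwistedRegauge_of_twist_T3` and `3·((4800((449∕2)e + τ) + 24576e) + 4096s) ≤ 1`: there is a Hermitian-traceless `D‴` with
`‖D‴ b‖ ≤ 2·((4800((449∕2)e + τ) + 24576e)·L^{−(K−n)} + 4096s)`, `wilsonAction4 (X^u) = wilsonAction4 (emb15 W (expHermField D‴))` and `emb15 W (expHermField D‴) ∈ (6)(e) ∩ 𝔅_k(V)`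
— `D‴ = −i·log((X^g)_b W_b⁻¹)` for the re-gauging `g` above. [cite: Balaban1985Variational, (4)-(6) p.278, (15) p.280, (112) p.294, (141)-(143) p.299; Balaban1985RegularSpaces, Lemma 1 p.79] -/
theorem exists_untwistedChart_of_twist_T3 (hL : 7 ≤ F.L) {e s τ : ℝ} (hτ0 : 0 ≤ τ)
    (hε0 : 50 * (500 * (F.L : ℝ) + 7 * (F.L : ℝ) ^ 2) * e ≤ 1) (hD : 4800 * ((449 / 2) * e + τ) ≤ 1) (hρ : 4096 * (s + 6 * e) ≤ 1)
    (h3 : 3 * ((4800 * ((449 / 2) * e + τ) + 24576 * e) + 4096 * s) ≤ 1)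
    {V : GaugeField (F.P n) 0 (Matrix.specialUnitaryGroup (Fin 2) ℂ)} (W X : GaugeField (F.P K) 0 (Matrix.specialUnitaryGroup (Fin 2) ℂ))
    (u : GaugeTransf (F.P K) 0 (Matrix.specialUnitaryGroup (Fin 2) ℂ))
    (hW : W ∈ regFibrePr F n K h e V) (hXu : GaugeField.gaugeAct u X ∈ regFibrePr F n K h e V)
    (hs : ∀ b : PBond (F.P K) 0, dist1 (X b * (W b)⁻¹) ≤ s)
    (hτ : ∀ c : PBond (F.P K) (K - n), dist1 (Averaging.iter (fun j => blockAvg (P := F.P K) (j := j) (ExpMeanLog.expMeanLogSU (n := Fin 2))) (K - n) X c *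
        (Averaging.iter (fun j => blockAvg (P := F.P K) (j := j) (ExpMeanLog.expMeanLogSU (n := Fin 2))) (K - n) W c)⁻¹) ≤ τ) :
    ∃ D : PBond (F.P K) 0 → Matrix (Fin 2) (Fin 2) ℂ,
      (∀ b : PBond (F.P K) 0, (D b).IsHermitian ∧ Matrix.trace (D b) = 0) ∧
      (∀ b : PBond (F.P K) 0, ‖D b‖ ≤ 2 * ((4800 * ((449 / 2) * e + τ) + 24576 * e) * (((F.L : ℝ))⁻¹) ^ (K - n) + 4096 * s)) ∧
      wilsonAction4 (GaugeField.gaugeAct u X) = wilsonAction4 (emb15 W (expHermField D)) ∧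
      emb15 W (expHermField D) ∈ regFibrePr F n K h e V := by
  obtain ⟨g, hg, hbound⟩ := exists_untwistedRegauge_of_twist_T3 F h hL hτ0 hε0 hD hρ W X u hW hXu hs hτ
  have hL0 : (0 : ℝ) < (F.L : ℝ) := by exact_mod_cast (show 0 < F.L by omega)
  have hη1 : (((F.L : ℝ))⁻¹) ^ (K - n) ≤ 1 := pow_le_one₀ (inv_nonneg.mpr hL0.le) (inv_le_one_of_one_le₀ (by exact_mod_cast (show 1 ≤ F.L by omega)))
  have he0 : 0 ≤ e := (pos_of_regPr F ((mem_regFibrePr_iff F).mp hW).2).le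
  have hC0 : 0 ≤ 4800 * ((449 / 2) * e + τ) + 24576 * e := by positivity
  set Q : PBond (F.P K) 0 → Matrix.specialUnitaryGroup (Fin 2) ℂ := fun b => GaugeField.gaugeAct g X b * (W b)⁻¹ with hQdef
  have hQ1 : ∀ b, ‖(Q b : Matrix (Fin 2) (Fin 2) ℂ) - 1‖ ≤ (4800 * ((449 / 2) * e + τ) + 24576 * e) * (((F.L : ℝ))⁻¹) ^ (K - n) + 4096 * s :=
    fun b => hbound b
  have hthird : ∀ b, ‖(Q b : Matrix (Fin 2) (Fin 2) ℂ) - 1‖ ≤ 1 / 3 := fun b => by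
    refine (hQ1 b).trans ?_
    have : (4800 * ((449 / 2) * e + τ) + 24576 * e) * (((F.L : ℝ))⁻¹) ^ (K - n) ≤ (4800 * ((449 / 2) * e + τ) + 24576 * e) * 1 := by gcongr
    linarith
  refine ⟨fun b => (-Complex.I) • mlog (Q b : Matrix (Fin 2) (Fin 2) ℂ), fun b => ?_, fun b => ?_, ?_⟩
  · have hQb := Matrix.mem_specialUnitaryGroup_iff.1 (Q b).2
    exact ⟨hermLog_isHermitian hQb.1 (hthird b), hermLog_trace hQb.2 (hthird b)⟩
  · exact (norm_hermLog_le ((hthird b).trans (by norm_num))).trans (by linarith [hQ1 b])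
  · have hcfg : emb15 W (expHermField fun b => (-Complex.I) • mlog (Q b : Matrix (Fin 2) (Fin 2) ℂ)) = GaugeField.gaugeAct g X := by
      funext b
      show expHerm ((-Complex.I) • mlog (Q b : Matrix (Fin 2) (Fin 2) ℂ)) * W b = GaugeField.gaugeAct g X b
      rw [expHerm_hermLog (Q b) (hthird b), hQdef, inv_mul_cancel_right]
    refine ⟨?_, by rw [hcfg]; exact hg⟩
    rw [hcfg, show wilsonAction4 (GaugeField.gaugeAct u X) = wilsonAction4 X from T4WilsonGaugeFlatDirection.wilsonAction_gaugeAct 1 u X]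
    exact (T4WilsonGaugeFlatDirection.wilsonAction_gaugeAct 1 g X).symm

end Assembly

end Summit.QuantumFields.YangMills.Theorems.Prop7UntwistChartOfTwist

end
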